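import Literature.NumberTheory.LFunctions.IvicNearOneClassOne
import Literature.NumberTheory.LFunctions.IvicNearOneDetection
import Literature.NumberTheory.LFunctions.ZeroDensityNearOneTools
import HarnessLib

/-!
# Ivić 1985, Theorem 11.3: the per-height-block well-spaced count and the height sum

NOT RH-BEARING (D-0040; bears_on LADDER-RH §4 HELD row `DensityLadder`, stmt-19600): a density
theorem counts zeros off the line, it never empties the strip (Barrier `LindelofBacklund`);
corpus theorems are RH-FREE literature and nothing in this file is worded as progress toward RH.

Composition of the nodes of the discharge of `Ivic1985_theorem11_3` on ONE dyadic height block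
`(U, 2U]` (Ivić (11.12): every counted zero is class I (11.44) or class II (11.45); `R₁` by
(11.46)–(11.48), `R₂` by (11.49)–(11.51)): `NearOneDetect.perZero_dichotomy_line` splits a
`1`-separated set of zeros `Z` into `Z₁ ∪ Z₂`; `Z₁` is counted by `IvicClassOne.count`
(`IvicNearOneClassOne.lean`) and `Z₂`, grouped by the index of the large Möbius block (the
class-II extraction, `IvicClassTwo.extract`), by the class-II block count (`IvicClassTwo.count`,
both in `IvicNearOneClassTwo.lean`). The two class-II statements enter `wellSpaced_le` as
HYPOTHESES `hK2c`, `hK2a` (their texts specialised to the block's parameters, the truncated Möbius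
coefficient abstracted as `mt`), so that this file does not depend on the class-II file; the apex
instantiates them. The output of `wellSpaced_le` is exactly the `hws` input of
`ZeroDensity.count_dyadic_le_of_local`, and `count_le_of_wellSpaced` (Ivić (11.11)–(11.12)) sums
it over the dyadic heights.

## References
* [Ivic1985] A. Ivić, *The Riemann zeta-function*, Wiley 1985, §11.2 (11.11)–(11.12) p. 271,
  §11.4 (11.41)–(11.51) pp. 279–281.
-/

noncomputable section

open Complex Filter Topology Set MeasureTheory Finset
open scoped Real

namespace Literature.NumberTheory.LFunctions

namespace IvicApex

open ZeroDetect NearOneDetect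

/-! ## The block indices `J` (detector blocks from `X` up to `Y`) and `J₂` (mollifier blocks) -/

/-- **Detector blocks**: for `X, Y ≥ 1` there is `J` with `Y ≤ X·2^J`, `X·2^i < Y` for `i < J`
and `J ≤ 1 + 2 log Y` (the least `J`; the dyadic decomposition `M(s) = Σ_k M_k(s)` of the
detector). [cite: Ivic1985, §11.4, proof of Theorem 11.3, (11.41)–(11.42), p. 279] -/
theorem exists_blocks {X Y : ℕ} (hX : 1 ≤ X) (hY : 1 ≤ Y) :
    ∃ J : ℕ, Y ≤ X * 2 ^ J ∧ (∀ i < J, X * 2 ^ i < Y) ∧ (J : ℝ) ≤ 1 + 2 * Real.log Y := by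
  classical
  have hex : ∃ J : ℕ, Y ≤ X * 2 ^ J := by
    obtain ⟨n, hn⟩ := pow_unbounded_of_one_lt (Y : ℝ) (by norm_num : (1 : ℝ) < 2)
    refine ⟨n, ?_⟩
    have : (Y : ℝ) ≤ (X : ℝ) * 2 ^ n := by
      have hX1 : (1 : ℝ) ≤ X := by exact_mod_cast hX
      nlinarith [hn.le, pow_pos (by norm_num : (0:ℝ) < 2) n]
    exact_mod_cast this
  refine ⟨Nat.find hex, Nat.find_spec hex, fun i hi ↦ ?_, ?_⟩
  · have := Nat.find_min hex hi
    omega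
  · set J := Nat.find hex with hJ
    rcases Nat.eq_zero_or_pos J with h0 | hpos
    · rw [h0]; simp; positivity
    · have hmin : ¬ (Y ≤ X * 2 ^ (J - 1)) := Nat.find_min hex (by omega)
      have hlt : X * 2 ^ (J - 1) < Y := by omega
      have h2 : (2 : ℝ) ^ (J - 1) < Y := by
        have : 2 ^ (J - 1) ≤ X * 2 ^ (J - 1) := Nat.le_mul_of_pos_left _ hX
        exact_mod_cast lt_of_le_of_lt this hlt
      have hY0 : (0 : ℝ) < Y := by exact_mod_cast hY
      have h3 : ((J - 1 : ℕ) : ℝ) * Real.log 2 < Real.log Y := by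
        rw [← Real.log_pow]
        exact Real.log_lt_log (by positivity) h2
      have hlog2 : (1 : ℝ) / 2 ≤ Real.log 2 := by
        have := Real.log_two_gt_d9; linarith
      have hJ1 : ((J - 1 : ℕ) : ℝ) = (J : ℝ) - 1 := by
        rw [Nat.cast_sub hpos]; simp
      rw [hJ1] at h3
      have hlogY0 : 0 ≤ Real.log Y := Real.log_nonneg (by exact_mod_cast hY)
      nlinarith

/-- **Mollifier blocks**: for `X ≥ 1`, `J₂ := Nat.log 2 X + 1` satisfies `X ≤ 2^{J₂}`, `1 ≤ J₂`,
`2^{J₂} ≤ 2X` and `J₂ ≤ 1 + 2 log X + 1`. (the dyadic decomposition of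
`M_X(s) = Σ_{n ≤ X} μ(n) n^{-s}` into `O(log X)` blocks).
[cite: Ivic1985, §11.4, proof of Theorem 11.3, (11.49)–(11.50), p. 280] -/
theorem mollifier_blocks {X : ℕ} (hX : 1 ≤ X) :
    X ≤ 2 ^ (Nat.log 2 X + 1) ∧ 1 ≤ Nat.log 2 X + 1 ∧ 2 ^ (Nat.log 2 X + 1) ≤ 2 * X ∧
      ((Nat.log 2 X + 1 : ℕ) : ℝ) ≤ 2 + 2 * Real.log X := by
  have h1 : X < 2 ^ (Nat.log 2 X + 1) := Nat.lt_pow_succ_log_self (by norm_num) X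
  have h2 : 2 ^ Nat.log 2 X ≤ X := Nat.pow_log_le_self 2 (by omega)
  refine ⟨h1.le, by omega, by rw [pow_succ]; omega, ?_⟩
  have hX0 : (0 : ℝ) < X := by exact_mod_cast hX
  have h3 : ((Nat.log 2 X : ℕ) : ℝ) * Real.log 2 ≤ Real.log X := by
    rw [← Real.log_pow]
    exact Real.log_le_log (by positivity) (by exact_mod_cast h2)
  have hlog2 : (1 : ℝ) / 2 ≤ Real.log 2 := by
    have := Real.log_two_gt_d9; linarith
  have hlogX0 : 0 ≤ Real.log X := Real.log_nonneg (by exact_mod_cast hX)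
  push_cast
  nlinarith

/-- **Per-height-block count** (Ivić (11.12) with (11.44)–(11.51) on the block `U < γ ≤ 2U`).
Notation: `α = 5σ − 4`, `κ = 64/3 + 16 log(1/(σ−α))`, `Φ = 4M + 6/(1−α) + 14K`; `mt` stands for the
truncated Möbius coefficient `μ(n)·[n ≤ X]` of node K-2 (`IvicClassTwo.mobTrunc X`), about which
only `hK2a`/`hK2c` are used. Under the residue condition `hres` of the dichotomy, K-1's absorption
`habs₁` ((11.48)) and K-2's absorption `habs₂` ((11.51)) with a class-II level `0 < V ≤` the level
exported by K-2's `extract`, every `1`-separated finite set `Z` of zeros `ρ` of `ζ` with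
`σ ≤ Re ρ`, `U < Im ρ ≤ 2U` has
`|Z| ≤ 267264·J³·Y^{2(1−σ)}·(1+log 2Y)³ + J₂·928·κ²·(2^{J₂})^{2−2α}/V²`.
[cite: Ivic1985, §11.2 (11.12) and §11.4 (11.44)–(11.51), pp. 271, 280–281] -/
theorem wellSpaced_le {σ : ℝ} (hσ : 9 / 10 ≤ σ) (hσ1 : σ < 1)
    {X Y J J₂ : ℕ} (hX : 1 ≤ X) (hY4 : 4 ≤ Y) (hJ : ∀ i < J, X * 2 ^ i < Y)
    (hJY : Y ≤ X * 2 ^ J) {U T M K V : ℝ} (hU : 2 ≤ U) (hUT : U ≤ T)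
    (hM : 0 < M) (hK0 : 0 ≤ K)
    (hMt : ∀ t : ℝ, 1 ≤ |t| → |t| ≤ 3 * T →
      ‖riemannZeta (((5 * σ - 4 : ℝ) : ℂ) + t * I)‖ ≤ M)
    (hKall : ∀ α' t : ℝ, 1 / 2 ≤ α' → α' < 1 →
      ‖riemannZeta ((α' : ℂ) + t * I)‖ ≤ 1 / (1 - α') + K * (1 + |t|))
    (hres : 2 * (Y : ℝ) ^ (1 - σ) * (1 + Real.log X) / U ^ 3 ≤ 1 / 8)
    (habs₁ : 18 * (64 * (J : ℝ) ^ 2) * (8 * (4 * M + 6 / (5 * (1 - σ)) + 14 * K) *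
      (X : ℝ) ^ (-(3 * (1 - σ))) * (1 + Real.log (2 * Y)) ^ 3) ≤ 1)
    (hV : 0 < V)
    (habs₂ : 32 * (64 / 3 + 16 * Real.log (1 / (σ - (5 * σ - 4)))) ^ 2 *
      (4 * M + 6 / (1 - (5 * σ - 4)) + 14 * K) * ((2 : ℝ) ^ J₂) ^ (1 - (5 * σ - 4)) ≤ V ^ 2)
    (mt : ℕ → ℂ)
    (hK2c : ∀ ρ : ℂ, σ ≤ ρ.re → ρ.re < 1 → U < ρ.im → ρ.im ≤ 2 * U →
      5 * π / 8 * (Y : ℝ) ^ (σ - (5 * σ - 4)) ≤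
        ∫ y : ℝ, ‖rieszK ((((5 * σ - 4) - ρ.re : ℝ) : ℂ) + y * I)‖ *
          (‖riemannZeta ((5 * σ - 4 : ℝ) + (ρ.im + y) * I)‖ *
            ‖mollifier X ((5 * σ - 4 : ℝ) + (ρ.im + y) * I)‖) →
      ∃ i < J₂, V ≤ ∫ y : ℝ, ‖rieszK ((((5 * σ - 4) - ρ.re : ℝ) : ℂ) + y * I)‖ *
        ‖∑ n ∈ Finset.Ioc (2 ^ i) (2 * 2 ^ i),
          mt n * (n : ℂ) ^ (-(((5 * σ - 4 : ℝ) : ℂ) + (ρ.im + y) * I))‖)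
    (hK2a : ∀ N : ℕ, 1 ≤ N → ∀ Z : Finset ℂ,
      (∀ ρ ∈ Z, σ ≤ ρ.re ∧ ρ.re < 1 ∧ U < ρ.im ∧ ρ.im ≤ 2 * U) →
      (∀ ρ ∈ Z, ∀ ρ' ∈ Z, ρ ≠ ρ' → 1 ≤ |ρ.im - ρ'.im|) →
      (∀ ρ ∈ Z, V ≤ ∫ y : ℝ, ‖rieszK ((((5 * σ - 4) - ρ.re : ℝ) : ℂ) + y * I)‖ *
        ‖∑ n ∈ Finset.Ioc N (2 * N),
          mt n * (n : ℂ) ^ (-(((5 * σ - 4 : ℝ) : ℂ) + (ρ.im + y) * I))‖) →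
      32 * (64 / 3 + 16 * Real.log (1 / (σ - (5 * σ - 4)))) ^ 2 *
        (4 * M + 6 / (1 - (5 * σ - 4)) + 14 * K) * (N : ℝ) ^ (1 - (5 * σ - 4)) ≤ V ^ 2 →
      (Z.card : ℝ) ≤ 928 * (64 / 3 + 16 * Real.log (1 / (σ - (5 * σ - 4)))) ^ 2 *
        (N : ℝ) ^ (2 - 2 * (5 * σ - 4)) / V ^ 2)
    (Z : Finset ℂ)
    (hZ : ∀ ρ ∈ Z, riemannZeta ρ = 0 ∧ σ ≤ ρ.re ∧ U < ρ.im ∧ ρ.im ≤ 2 * U)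
    (hsep : ∀ ρ ∈ Z, ∀ ρ' ∈ Z, ρ ≠ ρ' → 1 ≤ |ρ.im - ρ'.im|) :
    (Z.card : ℝ) ≤ 267264 * (J : ℝ) ^ 3 * (Y : ℝ) ^ (2 * (1 - σ)) * (1 + Real.log (2 * Y)) ^ 3 +
      J₂ * (928 * (64 / 3 + 16 * Real.log (1 / (σ - (5 * σ - 4)))) ^ 2 *
        ((2 : ℝ) ^ J₂) ^ (2 - 2 * (5 * σ - 4)) / V ^ 2) := by
  classical
  set α : ℝ := 5 * σ - 4 with hαdef
  have hα : 1 / 2 ≤ α := by rw [hαdef]; linarith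
  have hασ : α < σ := by rw [hαdef]; linarith
  have hα1 : α < 1 := by linarith
  have h1α : 0 < 1 - α := by linarith
  have hY1 : 1 ≤ Y := by omega
  have hU1 : 1 ≤ U := by linarith
  set κ : ℝ := 64 / 3 + 16 * Real.log (1 / (σ - α)) with hκ
  set Φ : ℝ := 4 * M + 6 / (1 - α) + 14 * K with hΦ
  -- real parts `< 1`
  have hre1 : ∀ ρ ∈ Z, ρ.re < 1 := by
    intro ρ hρ
    by_contra h
    exact riemannZeta_ne_zero_of_one_le_re (not_lt.1 h) (hZ ρ hρ).1
  -- the class-I / class-II split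
  set P : ℂ → Prop := fun ρ ↦ 1 / 8 ≤ ‖∑ n ∈ Finset.Ioc X (X * 2 ^ J),
    ZeroDensity.coeffB X Y n * (n : ℂ) ^ (-ρ)‖ with hP
  set Z₁ : Finset ℂ := Z.filter P with hZ₁
  set Z₂ : Finset ℂ := Z.filter (fun ρ ↦ ¬ P ρ) with hZ₂
  have hsplit : Z.card = Z₁.card + Z₂.card := by
    rw [hZ₁, hZ₂]; exact (Finset.card_filter_add_card_filter_not P).symm
  have hsub₁ : Z₁ ⊆ Z := Finset.filter_subset _ _
  have hsub₂ : Z₂ ⊆ Z := Finset.filter_subset _ _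
  -- class I
  have hcount₁ : (Z₁.card : ℝ) ≤
      267264 * (J : ℝ) ^ 3 * (Y : ℝ) ^ (2 * (1 - σ)) * (1 + Real.log (2 * Y)) ^ 3 := by
    refine IvicClassOne.count hσ hσ1 hX hY1 hJ hU1 hUT hM.le hK0 hMt
      (fun t ↦ hKall (5 * σ - 4) t (by linarith) (by linarith)) habs₁ Z₁ ?_ ?_ ?_
    · intro ρ hρ
      have hρZ := hsub₁ hρ
      exact ⟨(hZ ρ hρZ).2.1, hre1 ρ hρZ, (hZ ρ hρZ).2.2.1, (hZ ρ hρZ).2.2.2⟩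
    · exact fun ρ hρ ρ' hρ' hne ↦ hsep ρ (hsub₁ hρ) ρ' (hsub₁ hρ') hne
    · intro ρ hρ
      exact (Finset.mem_filter.1 hρ).2
  -- class II: every `ρ ∈ Z₂` satisfies the class-II inequality, hence has a block index
  have hII : ∀ ρ ∈ Z₂, ∃ i < J₂, V ≤ ∫ y : ℝ, ‖rieszK (((α - ρ.re : ℝ) : ℂ) + y * I)‖ *
      ‖∑ n ∈ Finset.Ioc (2 ^ i) (2 * 2 ^ i),
        mt n * (n : ℂ) ^ (-((α : ℂ) + (ρ.im + y) * I))‖ := by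
    intro ρ hρ
    obtain ⟨hρZ, hnot⟩ := Finset.mem_filter.1 hρ
    obtain ⟨hζ, hβ, hγ1, hγ2⟩ := hZ ρ hρZ
    have hd := perZero_dichotomy_line hα hασ hX hY4 hJY hU1 hres hζ hβ hγ1
    rcases hd with h1 | h2
    · exact absurd h1 hnot
    · exact hK2c ρ hβ (hre1 ρ hρZ) hγ1 hγ2 h2
  -- group `Z₂` by the block index
  choose! idx hidx using hII
  set Zi : ℕ → Finset ℂ := fun i ↦ Z₂.filter (fun ρ ↦ idx ρ = i) with hZi
  have hcover : Z₂ = (Finset.range J₂).biUnion Zi := by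
    ext ρ
    simp only [hZi, Finset.mem_biUnion, Finset.mem_range, Finset.mem_filter]
    constructor
    · intro hρ
      exact ⟨idx ρ, (hidx ρ hρ).1, hρ, rfl⟩
    · rintro ⟨i, -, hρ, -⟩
      exact hρ
  have hcard₂ : Z₂.card ≤ ∑ i ∈ Finset.range J₂, (Zi i).card := by
    rw [hcover]; exact Finset.card_biUnion_le
  -- the per-block count
  have hblock : ∀ i ∈ Finset.range J₂, ((Zi i).card : ℝ) ≤
      928 * κ ^ 2 * ((2 : ℝ) ^ J₂) ^ (2 - 2 * α) / V ^ 2 := by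
    intro i hi
    rw [Finset.mem_range] at hi
    have hN : 1 ≤ 2 ^ i := Nat.one_le_two_pow
    have hsubi : Zi i ⊆ Z := fun ρ hρ ↦ hsub₂ (Finset.mem_filter.1 hρ).1
    have hpow_le : ((2 ^ i : ℕ) : ℝ) ≤ (2 : ℝ) ^ J₂ := by
      have : (2 : ℕ) ^ i ≤ 2 ^ J₂ := Nat.pow_le_pow_right (by norm_num) hi.le
      exact_mod_cast this
    have hpow0 : (0 : ℝ) < ((2 ^ i : ℕ) : ℝ) := by positivity
    have habsN : 32 * κ ^ 2 * Φ * ((2 ^ i : ℕ) : ℝ) ^ (1 - α) ≤ V ^ 2 := by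
      have hmono : ((2 ^ i : ℕ) : ℝ) ^ (1 - α) ≤ ((2 : ℝ) ^ J₂) ^ (1 - α) :=
        Real.rpow_le_rpow hpow0.le hpow_le h1α.le
      have hΦ0 : 0 ≤ 32 * κ ^ 2 * Φ := by
        have : 0 ≤ Φ := by rw [hΦ]; positivity
        positivity
      calc 32 * κ ^ 2 * Φ * ((2 ^ i : ℕ) : ℝ) ^ (1 - α)
          ≤ 32 * κ ^ 2 * Φ * ((2 : ℝ) ^ J₂) ^ (1 - α) := mul_le_mul_of_nonneg_left hmono hΦ0
        _ ≤ V ^ 2 := by simpa only [hκ, hΦ, hαdef] using habs₂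
    have h := hK2a (2 ^ i) hN (Zi i)
      (fun ρ hρ ↦ by
        have hρZ := hsubi hρ
        exact ⟨(hZ ρ hρZ).2.1, hre1 ρ hρZ, (hZ ρ hρZ).2.2.1, (hZ ρ hρZ).2.2.2⟩)
      (fun ρ hρ ρ' hρ' hne ↦ hsep ρ (hsubi hρ) ρ' (hsubi hρ') hne)
      (fun ρ hρ ↦ by
        obtain ⟨hρ₂, hρi⟩ := Finset.mem_filter.1 hρ
        have h := (hidx ρ hρ₂).2
        rw [hρi] at h
        simpa only [hαdef] using h)
      (by simpa only [hκ, hΦ, hαdef] using habsN)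
    have hconcl : (928 : ℝ) * κ ^ 2 * ((2 ^ i : ℕ) : ℝ) ^ (2 - 2 * α) / V ^ 2 ≤
        928 * κ ^ 2 * ((2 : ℝ) ^ J₂) ^ (2 - 2 * α) / V ^ 2 := by
      have hmono : ((2 ^ i : ℕ) : ℝ) ^ (2 - 2 * α) ≤ ((2 : ℝ) ^ J₂) ^ (2 - 2 * α) :=
        Real.rpow_le_rpow hpow0.le hpow_le (by linarith)
      have hV2 : 0 < V ^ 2 := by positivity
      refine div_le_div_of_nonneg_right ?_ hV2.le
      exact mul_le_mul_of_nonneg_left hmono (by positivity)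
    have h' : ((Zi i).card : ℝ) ≤ 928 * κ ^ 2 * ((2 ^ i : ℕ) : ℝ) ^ (2 - 2 * α) / V ^ 2 := by
      simpa only [hκ, hαdef] using h
    exact h'.trans hconcl
  have hcount₂ : (Z₂.card : ℝ) ≤ J₂ * (928 * κ ^ 2 * ((2 : ℝ) ^ J₂) ^ (2 - 2 * α) / V ^ 2) := by
    calc (Z₂.card : ℝ) ≤ ∑ i ∈ Finset.range J₂, ((Zi i).card : ℝ) := by exact_mod_cast hcard₂
      _ ≤ ∑ i ∈ Finset.range J₂, (928 * κ ^ 2 * ((2 : ℝ) ^ J₂) ^ (2 - 2 * α) / V ^ 2) :=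
          Finset.sum_le_sum hblock
      _ = J₂ * (928 * κ ^ 2 * ((2 : ℝ) ^ J₂) ^ (2 - 2 * α) / V ^ 2) := by
          rw [Finset.sum_const, Finset.card_range, nsmul_eq_mul]
  -- assemble
  have hZcard : (Z.card : ℝ) = Z₁.card + Z₂.card := by rw [hsplit]; push_cast; ring
  rw [hZcard]
  have := add_le_add hcount₁ hcount₂
  simpa only [hκ, hαdef] using this


/-! ## From the per-height-block count to `N(σ, T)` -/

/-- **Height sum** (Ivić (11.11)–(11.12)): if every `1`-separated finite set of zeros `ρ` with
`σ ≤ Re ρ`, `U < Im ρ ≤ 2U` has at most `W` elements whenever `γ₀ ≤ U` and `2U ≤ T` (`σ ≥ 1/4`,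
`γ₀ ≥ 1`, `2γ₀ ≤ T`, `W ≥ 0`), then
`N(σ,T) ≤ C₀(2γ₀+2)log(2γ₀+2) + 2W·C_w·log(2T+3)·(log T/log 2 + 1)`, where `C_w` is the
unit-window constant (`∑_{|Im ρ−τ|≤1/2} m(ρ) ≤ C_w log(|τ|+2)`) and `C₀` the trivial-count
constant (`N(σ,U) ≤ C₀(U+2)log(U+2)`, `U ≥ 1`). [cite: Ivic1985, §11.2 (11.11)–(11.12), p. 271] -/
theorem count_le_of_wellSpaced {σ T γ₀ W Cw C₀ : ℝ} (hσ : 1 / 4 ≤ σ) (hγ₀ : 1 ≤ γ₀)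
    (hT : 2 * γ₀ ≤ T) (hW : 0 ≤ W) (hCw0 : 0 ≤ Cw)
    (hCw : ∀ τ : ℝ, ∑ ρ ∈ (zetaZeroWindow_finite τ).toFinset,
      (riemannZetaZeroOrder ρ : ℝ) ≤ Cw * Real.log (|τ| + 2))
    (hC₀ : ∀ U : ℝ, 1 ≤ U → (zetaZeroCountRe σ U : ℝ) ≤ C₀ * (U + 2) * Real.log (U + 2))
    (hws : ∀ U : ℝ, γ₀ ≤ U → 2 * U ≤ T → ∀ Z : Finset ℂ,
      (∀ ρ ∈ Z, riemannZeta ρ = 0 ∧ σ ≤ ρ.re ∧ U < ρ.im ∧ ρ.im ≤ 2 * U) →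
      (∀ ρ ∈ Z, ∀ ρ' ∈ Z, ρ ≠ ρ' → 1 ≤ |ρ.im - ρ'.im|) → (Z.card : ℝ) ≤ W) :
    (zetaZeroCountRe σ T : ℝ) ≤ C₀ * (2 * γ₀ + 2) * Real.log (2 * γ₀ + 2) +
      2 * W * (Cw * Real.log (2 * T + 3)) * (Real.log T / Real.log 2 + 1) := by
  have hT1 : 1 ≤ T := by linarith
  set R : ℝ := 2 * W * (Cw * Real.log (2 * T + 3)) with hR
  have hlogT3 : 0 ≤ Real.log (2 * T + 3) := Real.log_nonneg (by linarith)
  have hR0 : 0 ≤ R := by rw [hR]; positivity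
  -- per block
  have hblock : ∀ U : ℝ, γ₀ ≤ U → 2 * U ≤ T →
      (zetaZeroCountRe σ (2 * U) : ℝ) - zetaZeroCountRe σ U ≤ R := by
    intro U hU hUT
    have hU1 : 1 ≤ U := le_trans hγ₀ hU
    have h := ZeroDensity.count_dyadic_le_of_local hσ hU1 (M := W)
      (fun Z hZ hsep ↦ hws U hU hUT Z hZ hsep) hCw
    refine h.trans ?_
    rw [hR]
    have hlog : Real.log (2 * U + 3) ≤ Real.log (2 * T + 3) :=
      Real.log_le_log (by linarith) (by linarith)
    have : Cw * Real.log (2 * U + 3) ≤ Cw * Real.log (2 * T + 3) :=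
      mul_le_mul_of_nonneg_left hlog hCw0
    exact mul_le_mul_of_nonneg_left this (by positivity)
  have h := ZeroDensity.zetaZeroCountRe_le_of_blocks hγ₀ hT hR0 hblock
  have hlow : (zetaZeroCountRe σ (2 * γ₀) : ℝ) ≤ C₀ * (2 * γ₀ + 2) * Real.log (2 * γ₀ + 2) :=
    hC₀ (2 * γ₀) (by linarith)
  linarith

end IvicApex

end Literature.NumberTheory.LFunctions
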